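import Summits.Ventures.QEC.Thresholds.ToricCodeHGPThresholdsTransport
import HarnessLib

/-!
# The census toric object `HGP(circ_L, circ_L)` inherits the lattice toric code's SAW-route thresholds, II (noisy measurement):
# `p_c^{ph} > .0112` (both records), two-rate boxes `p₀(4.7476)`, three-rate `p ≤ .0168`, `q ≤ .0112`
# — every minimum-weight space-time decoder family — UNCONDITIONAL, kernel

Venture QEC, `Summits/Ventures/QEC/Thresholds/` (LADDER-QEC rung Q5, CENSUS-PREREG cell B.0 / Q5 row F5; qec-type-09 gen 5, item
TORHGP-TRANSPORT, companion of `ToricCodeHGPThresholdsTransport.lean`). The space-time decoding problem of the census object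
`toricHGPCode k` is the re-indexed one of the lattice toric code `toricCode (k+2)` (qec-type-03's `toricHGPCode_eq_reindex` with
`CSSPhenomenologicalReindex.lean`: pulled-back space-time decoders, `CSSPhenom.phenomFailureProb_pullback`,
`CSSPhenom.isMinWeight_pullback`); index shift `k ↦ k + 1` with the schedule `T' L = T (L - 1)` (`isPolyBounded_pred`). Hence:

| theorem | statement (HGP object `toricHGPCode k`, schedule `T`, every `k`) |
|---|---|
| `toricHGP_z_phenom_isThresholdLowerBound_of_lattice`, `toricHGP_x_phenom_isThresholdLowerBound_of_lattice` (+ `…Box…_of_lattice`) | TRANSFER: lattice phenomenological bounds / boxes valid for every poly schedule and every min-weight space-time decoder family hold for the HGP object, star and plaquette records |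
| `toricHGP_z_phenom_accuracyThreshold_gt_0112`, `toricHGP_x_phenom_accuracyThreshold_gt_0112` | `q = p`, poly `T`: **`p_c^{ph} > .0112`** both records (was `.0101`, `ToricCodeHGPThresholds.lean`) |
| `toricHGP_z_phenom_isThresholdBoxLowerBound_kernelZ3SymmK12`, `toricHGP_x_phenom_isThresholdBoxLowerBound_kernelZ3SymmK12` | two-rate boxes `p₀(4.7476)` (was `p₀(5)`, `HGPInstancesBoxThresholds.lean`) |
| `toricHGP_depolPhenom_belowThreshold_0168_0112` | three-rate phenomenological depolarizing, sector-wise min-weight space-time decoding: **`p ≤ .0168`, `q_X, q_Z ≤ .0112` ⇒ `P_fail → 0`** (was `.0151 / .0101`, `CSSFamilyPhenomenologicalDepolarizing.lean`) |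

All UNCONDITIONAL, tier CERTIFIED (kernel), axioms standard, 0 named facts. Theorem-only file.

## References

* [KovalevPryadko2012] A. A. Kovalev, L. P. Pryadko, arXiv:1202.0928, Examples 2 and 6 (toric codes as hypergraph products).
* [DennisEtAl2002] E. Dennis, A. Kitaev, A. Landahl, J. Preskill, J. Math. Phys. 43 (2002) 4452, arXiv:quant-ph/0110143, §5.3
  eqs. (threshold_iso), (threshold_iso_num) (and "T increasing no faster than a polynomial of L").
* [LinPryadko2024] H.-K. Lin, L. P. Pryadko, §4.2 Thm 6 (permutation-equivalent CSS codes).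
* [AliferisGottesmanPreskill2006] P. Aliferis, D. Gottesman, J. Preskill, arXiv:quant-ph/0504218, §8.2 (chunk p0026 L11: depolarizing).
* [PonitzTittmann2000] A. Pönitz, P. Tittmann, Electron. J. Combin. 7 (2000) R21, Table 2 (`4.7476`).
-/

noncomputable section

namespace Summit.Ventures.QEC.Thresholds

open Filter Topology Finset Matrix
open Literature.InformationTheory.QuantumCodes
open Literature.InformationTheory.QuantumCodes.ToricCode
open Literature.Probability.RandomPlanarGeometry

/-! ### Phenomenological noise: index-shift plumbing -/

/-- A polynomially bounded schedule stays polynomially bounded after the index shift `L ↦ L - 1`.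
[cite: DennisEtAl2002, §5.3 (T increasing no faster than a polynomial of L)] -/
theorem isPolyBounded_pred {T : ℕ → ℕ} (hT : IsPolyBounded T) : IsPolyBounded fun L => T (L - 1) := by
  obtain ⟨A, a, hA⟩ := hT
  refine ⟨A, a, fun L => (hA (L - 1)).trans ?_⟩
  have hA0 : 0 ≤ A := by
    have h0 := hA 0
    simp only [Nat.cast_zero, zero_add, one_pow, mul_one] at h0
    exact (Nat.cast_nonneg _).trans h0
  gcongr
  exact_mod_cast Nat.sub_le L 1

/-- Threshold boxes are insensitive to an index shift of the family. [folklore] -/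
theorem isThresholdBoxLowerBound_succ_iff (P : ℕ → ℝ → ℝ → ℝ) (ρ₀ : ℝ) :
    IsThresholdBoxLowerBound (fun i => P (i + 1)) ρ₀ ↔ IsThresholdBoxLowerBound P ρ₀ := by
  constructor
  · intro h p q hp hq hp' hq'
    exact (Filter.tendsto_add_atTop_iff_nat (f := fun i => P i p q) 1).1 (h p q hp hq hp' hq')
  · intro h p q hp hq hp' hq'
    exact (Filter.tendsto_add_atTop_iff_nat (f := fun i => P i p q) 1).2 (h p q hp hq hp' hq')

/-! ### Phenomenological noise, `Z` sector (star record) -/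

/-- **Size-by-size identity, `Z` sector, two rates**: the space-time failure probability of a decoder `D` of the HGP object
(`T` rounds, rates `p`, `q`) equals `ToricCode.phenomFailureProb (k+2) T` of its pulled-back space-time decoder.
[cite: LinPryadko2024, §4.2 Thm 6] [cite: DennisEtAl2002, §5.2 (Prob_fail)] -/
theorem toricHGP_zPhenomFailureProb_eq (k T : ℕ)
    (D : CSSPhenom.STDecoder (Fin (k + 2) × Fin (k + 2)) ((Fin (k + 2) × Fin (k + 2)) ⊕ (Fin (k + 2) × Fin (k + 2))) T)
    (p q : ℝ) :
    CSSPhenom.phenomFailureProb (toricHGPCode k).HX T ((toricHGPCode k).rowSpZ : Set (_ → ZMod 2)) D p q =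
      ToricCode.phenomFailureProb (k + 2) T
        (fun s : STSyndrome (k + 2) T =>
          D (s ∘ ⇑((toricVertexEquiv k).symm.prodCongr (Equiv.refl (Fin (T + 1)))).symm) ∘
            ⇑(Equiv.sumCongr ((toricQubitEquiv k).symm.prodCongr (Equiv.refl (Fin T)))
              ((toricVertexEquiv k).symm.prodCongr (Equiv.refl (Fin T)))))
        p q := by
  rw [toricHGPCode_eq_reindex, CSSCode.reindex_HX]
  exact CSSPhenom.phenomFailureProb_pullback (toricCode (k + 2)).HX _ _ T (SX := boundaries (k + 2))
    (fun x => CSSCode.mem_rowSpZ_reindex_iff (toricCode (k + 2)) _ _ _ x) D p q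

/-- The pulled-back space-time decoder of a minimum-weight space-time decoder of the HGP object's `Z` sector is a minimum-weight
space-time decoder of the lattice object. [cite: DennisEtAl2002, §5.1 eq. (E_min)] -/
theorem toricHGP_isMinWeight_stPullback (k T : ℕ)
    {D : CSSPhenom.STDecoder (Fin (k + 2) × Fin (k + 2)) ((Fin (k + 2) × Fin (k + 2)) ⊕ (Fin (k + 2) × Fin (k + 2))) T}
    (hD : D.IsMinWeight (CSSPhenom.stSyn (toricHGPCode k).HX T) (CSSPhenom.stCycles (toricHGPCode k).HX T) hammingNorm) :
    Decoder.IsMinWeight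
      (fun s : STSyndrome (k + 2) T =>
        D (s ∘ ⇑((toricVertexEquiv k).symm.prodCongr (Equiv.refl (Fin (T + 1)))).symm) ∘
          ⇑(Equiv.sumCongr ((toricQubitEquiv k).symm.prodCongr (Equiv.refl (Fin T)))
            ((toricVertexEquiv k).symm.prodCongr (Equiv.refl (Fin T)))))
      (stSyn (k + 2) T) (stCycles (k + 2) T) hammingNorm := by
  rw [toricHGPCode_eq_reindex, CSSCode.reindex_HX] at hD
  exact CSSPhenom.isMinWeight_pullback (toricCode (k + 2)).HX _ _ hD

/-- **Transfer principle, `Z` sector, phenomenological**: a lattice phenomenological threshold bound valid for EVERY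
polynomially bounded schedule and EVERY minimum-weight space-time decoder family holds for the HGP object's `Z` sector
(schedule `T`, any min-weight space-time decoder family). [cite: LinPryadko2024, §4.2 Thm 6] [cite: DennisEtAl2002, §5.3 eq. (threshold_iso)] -/
theorem toricHGP_z_phenom_isThresholdLowerBound_of_lattice {p₀ : ℝ}
    (hZ : ∀ (T' : ℕ → ℕ), IsPolyBounded T' → ∀ D' : (L : ℕ) → STDecoder (L + 1) (T' L),
      (∀ L, (D' L).IsMinWeight (stSyn (L + 1) (T' L)) (stCycles (L + 1) (T' L)) hammingNorm) →
        IsThresholdLowerBound (phenomFailureFamily T' D') p₀)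
    {T : ℕ → ℕ} (hT : IsPolyBounded T)
    (D : ∀ k, CSSPhenom.STDecoder (Fin (k + 2) × Fin (k + 2))
      ((Fin (k + 2) × Fin (k + 2)) ⊕ (Fin (k + 2) × Fin (k + 2))) (T k))
    (hD : ∀ k, (D k).IsMinWeight (CSSPhenom.stSyn (toricHGPCode k).HX (T k))
      (CSSPhenom.stCycles (toricHGPCode k).HX (T k)) hammingNorm) :
    IsThresholdLowerBound (zPhenomFailureFamily (fun k => toricHGPCode k) T D) p₀ := by
  -- shifted schedule `T' (k+1) = T k`
  let T' : ℕ → ℕ := fun L => T (L - 1)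
  have hT' : IsPolyBounded T' := isPolyBounded_pred hT
  let D' : (L : ℕ) → STDecoder (L + 1) (T' L) := fun L =>
    match L with
    | 0 => Decoder.minWeight (stSyn 1 (T' 0)) hammingNorm
    | k + 1 => fun s : STSyndrome (k + 2) (T k) =>
        D k (s ∘ ⇑((toricVertexEquiv k).symm.prodCongr (Equiv.refl (Fin (T k + 1)))).symm) ∘
          ⇑(Equiv.sumCongr ((toricQubitEquiv k).symm.prodCongr (Equiv.refl (Fin (T k))))
            ((toricVertexEquiv k).symm.prodCongr (Equiv.refl (Fin (T k)))))
  have hD' : ∀ L, (D' L).IsMinWeight (stSyn (L + 1) (T' L)) (stCycles (L + 1) (T' L)) hammingNorm := by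
    intro L
    cases L with
    | zero => exact ToricCode.isMinWeight_stMinWeight 1 (T' 0)
    | succ k => exact toricHGP_isMinWeight_stPullback k (T k) (hD k)
  have hfam : zPhenomFailureFamily (fun k => toricHGPCode k) T D = fun k => phenomFailureFamily T' D' (k + 1) := by
    funext k p
    exact toricHGP_zPhenomFailureProb_eq k (T k) (D k) p p
  rw [hfam, isThresholdLowerBound_succ_iff]
  exact hZ T' hT' D' hD'

/-- **`Z`-sector phenomenological threshold of `HGP(circ_L, circ_L)` `≥ p₀(4.7476)`**, poly `T`, every minimum-weight space-time
decoder family — UNCONDITIONAL, kernel. [cite: DennisEtAl2002, §5.3 eq. (threshold_iso_num)] -/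
theorem toricHGP_z_phenom_isThresholdLowerBound_kernelZ3SymmK12 {T : ℕ → ℕ} (hT : IsPolyBounded T)
    (D : ∀ k, CSSPhenom.STDecoder (Fin (k + 2) × Fin (k + 2))
      ((Fin (k + 2) × Fin (k + 2)) ⊕ (Fin (k + 2) × Fin (k + 2))) (T k))
    (hD : ∀ k, (D k).IsMinWeight (CSSPhenom.stSyn (toricHGPCode k).HX (T k))
      (CSSPhenom.stCycles (toricHGPCode k).HX (T k)) hammingNorm) :
    IsThresholdLowerBound (zPhenomFailureFamily (fun k => toricHGPCode k) T D) (thresholdValue 4.7476) :=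
  toricHGP_z_phenom_isThresholdLowerBound_of_lattice (fun _ hT' _ hD' => phenomThreshold_kernelZ3SymmK12 hT' hD') hT D hD

/-- **`p_c^{Z,ph} > .0112` for `HGP(circ_L, circ_L)`** (was `.0101`), poly `T`, every minimum-weight space-time decoder family —
UNCONDITIONAL, kernel. [cite: DennisEtAl2002, §5.3 eq. (threshold_iso_num)] -/
theorem toricHGP_z_phenom_accuracyThreshold_gt_0112 {T : ℕ → ℕ} (hT : IsPolyBounded T)
    (D : ∀ k, CSSPhenom.STDecoder (Fin (k + 2) × Fin (k + 2))
      ((Fin (k + 2) × Fin (k + 2)) ⊕ (Fin (k + 2) × Fin (k + 2))) (T k))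
    (hD : ∀ k, (D k).IsMinWeight (CSSPhenom.stSyn (toricHGPCode k).HX (T k))
      (CSSPhenom.stCycles (toricHGPCode k).HX (T k)) hammingNorm) :
    (0.0112 : ℝ) < accuracyThreshold (zPhenomFailureFamily (fun k => toricHGPCode k) T D) :=
  lt_of_lt_of_le thresholdValue_47476_bounds.1
    (le_accuracyThreshold (toricHGP_z_phenom_isThresholdLowerBound_kernelZ3SymmK12 hT D hD)
      ((thresholdValue_le_half _).trans (by norm_num)))

/-- **Transfer principle, `Z` sector, two-rate boxes**: a lattice threshold BOX valid for every polynomially bounded schedule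
and every minimum-weight space-time decoder family holds for the HGP object's `Z` sector. [cite: LinPryadko2024, §4.2 Thm 6]
[cite: DennisEtAl2002, §5.3 eq. (threshold_iso)] -/
theorem toricHGP_z_phenom_isThresholdBoxLowerBound_of_lattice {ρ₀ : ℝ}
    (hZ : ∀ (T' : ℕ → ℕ), IsPolyBounded T' → ∀ D' : (L : ℕ) → STDecoder (L + 1) (T' L),
      (∀ L, (D' L).IsMinWeight (stSyn (L + 1) (T' L)) (stCycles (L + 1) (T' L)) hammingNorm) →
        IsThresholdBoxLowerBound (phenomFailureFamily₂ T' D') ρ₀)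
    {T : ℕ → ℕ} (hT : IsPolyBounded T)
    (D : ∀ k, CSSPhenom.STDecoder (Fin (k + 2) × Fin (k + 2))
      ((Fin (k + 2) × Fin (k + 2)) ⊕ (Fin (k + 2) × Fin (k + 2))) (T k))
    (hD : ∀ k, (D k).IsMinWeight (CSSPhenom.stSyn (toricHGPCode k).HX (T k))
      (CSSPhenom.stCycles (toricHGPCode k).HX (T k)) hammingNorm) :
    IsThresholdBoxLowerBound (zPhenomFailureFamily₂ (fun k => toricHGPCode k) T D) ρ₀ := by
  let T' : ℕ → ℕ := fun L => T (L - 1)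
  have hT' : IsPolyBounded T' := isPolyBounded_pred hT
  let D' : (L : ℕ) → STDecoder (L + 1) (T' L) := fun L =>
    match L with
    | 0 => Decoder.minWeight (stSyn 1 (T' 0)) hammingNorm
    | k + 1 => fun s : STSyndrome (k + 2) (T k) =>
        D k (s ∘ ⇑((toricVertexEquiv k).symm.prodCongr (Equiv.refl (Fin (T k + 1)))).symm) ∘
          ⇑(Equiv.sumCongr ((toricQubitEquiv k).symm.prodCongr (Equiv.refl (Fin (T k))))
            ((toricVertexEquiv k).symm.prodCongr (Equiv.refl (Fin (T k)))))
  have hD' : ∀ L, (D' L).IsMinWeight (stSyn (L + 1) (T' L)) (stCycles (L + 1) (T' L)) hammingNorm := by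
    intro L
    cases L with
    | zero => exact ToricCode.isMinWeight_stMinWeight 1 (T' 0)
    | succ k => exact toricHGP_isMinWeight_stPullback k (T k) (hD k)
  have hfam : zPhenomFailureFamily₂ (fun k => toricHGPCode k) T D = fun k => phenomFailureFamily₂ T' D' (k + 1) := by
    funext k p q
    exact toricHGP_zPhenomFailureProb_eq k (T k) (D k) p q
  rw [hfam, isThresholdBoxLowerBound_succ_iff]
  exact hZ T' hT' D' hD'

/-- **Two-rate `Z`-sector box `p₀(4.7476)`** for the HGP object: every `0 ≤ p, q < p₀(4.7476)` is below threshold, poly `T`,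
every minimum-weight space-time decoder family — UNCONDITIONAL, kernel. [cite: DennisEtAl2002, §5.3 eqs. (threshold_iso), (threshold_iso_num)] -/
theorem toricHGP_z_phenom_isThresholdBoxLowerBound_kernelZ3SymmK12 {T : ℕ → ℕ} (hT : IsPolyBounded T)
    (D : ∀ k, CSSPhenom.STDecoder (Fin (k + 2) × Fin (k + 2))
      ((Fin (k + 2) × Fin (k + 2)) ⊕ (Fin (k + 2) × Fin (k + 2))) (T k))
    (hD : ∀ k, (D k).IsMinWeight (CSSPhenom.stSyn (toricHGPCode k).HX (T k))
      (CSSPhenom.stCycles (toricHGPCode k).HX (T k)) hammingNorm) :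
    IsThresholdBoxLowerBound (zPhenomFailureFamily₂ (fun k => toricHGPCode k) T D) (thresholdValue 4.7476) :=
  toricHGP_z_phenom_isThresholdBoxLowerBound_of_lattice
    (fun _ hT' _ hD' => phenom_isThresholdBoxLowerBound_kernelZ3SymmK12 hT' hD') hT D hD

/-! ### Phenomenological noise, `X` sector (plaquette record) -/

/-- **Size-by-size identity, `X` sector, two rates**: the HGP object's `X`-sector space-time failure probability equals the
lattice `X`-sector one of the pulled-back decoder (which `ToricCodeXSectorPhenomenologicalDual.lean` turns into a `Z`-sector one).
[cite: LinPryadko2024, §4.2 Thm 6] [cite: DennisEtAl2002, §4.1] -/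
theorem toricHGP_xPhenomFailureProb_eq (k T : ℕ)
    (DX : CSSPhenom.STDecoder (Fin (k + 2) × Fin (k + 2)) ((Fin (k + 2) × Fin (k + 2)) ⊕ (Fin (k + 2) × Fin (k + 2))) T)
    (p q : ℝ) :
    CSSPhenom.phenomFailureProb (toricHGPCode k).HZ T ((toricHGPCode k).rowSpX : Set (_ → ZMod 2)) DX p q =
      CSSPhenom.phenomFailureProb (toricCode (k + 2)).HZ T ((toricCode (k + 2)).rowSpX : Set (Chain (k + 2)))
        (fun s : CSSPhenom.STSyndrome (Vertex (k + 2)) T =>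
          DX (s ∘ ⇑((toricVertexEquiv k).symm.prodCongr (Equiv.refl (Fin (T + 1)))).symm) ∘
            ⇑(Equiv.sumCongr ((toricQubitEquiv k).symm.prodCongr (Equiv.refl (Fin T)))
              ((toricVertexEquiv k).symm.prodCongr (Equiv.refl (Fin T)))))
        p q := by
  rw [toricHGPCode_eq_reindex, CSSCode.reindex_HZ]
  exact CSSPhenom.phenomFailureProb_pullback (toricCode (k + 2)).HZ _ _ T
    (SX := ((toricCode (k + 2)).rowSpX : Set (Chain (k + 2))))
    (fun x => CSSCode.mem_rowSpX_reindex_iff (toricCode (k + 2)) _ _ _ x) DX p q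

/-- The pulled-back plaquette-record decoder of a minimum-weight one is minimum-weight (lattice `X` sector).
[cite: DennisEtAl2002, §5.1 eq. (E_min) (dual lattice)] -/
theorem toricHGP_isMinWeight_stPullback_x (k T : ℕ)
    {DX : CSSPhenom.STDecoder (Fin (k + 2) × Fin (k + 2)) ((Fin (k + 2) × Fin (k + 2)) ⊕ (Fin (k + 2) × Fin (k + 2))) T}
    (hDX : DX.IsMinWeight (CSSPhenom.stSyn (toricHGPCode k).HZ T) (CSSPhenom.stCycles (toricHGPCode k).HZ T) hammingNorm) :
    Decoder.IsMinWeight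
      (fun s : CSSPhenom.STSyndrome (Vertex (k + 2)) T =>
        DX (s ∘ ⇑((toricVertexEquiv k).symm.prodCongr (Equiv.refl (Fin (T + 1)))).symm) ∘
          ⇑(Equiv.sumCongr ((toricQubitEquiv k).symm.prodCongr (Equiv.refl (Fin T)))
            ((toricVertexEquiv k).symm.prodCongr (Equiv.refl (Fin T)))))
      (CSSPhenom.stSyn (toricCode (k + 2)).HZ T) (CSSPhenom.stCycles (toricCode (k + 2)).HZ T) hammingNorm := by
  rw [toricHGPCode_eq_reindex, CSSCode.reindex_HZ] at hDX
  exact CSSPhenom.isMinWeight_pullback (toricCode (k + 2)).HZ _ _ hDX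

/-- **Transfer principle, `X` sector, phenomenological**: a lattice `X`-sector (plaquette-record) threshold bound valid for
every polynomially bounded schedule and every minimum-weight space-time decoder family holds for the HGP object's `X` sector.
[cite: LinPryadko2024, §4.2 Thm 6] [cite: DennisEtAl2002, §4.1 and §5.3 eq. (threshold_iso)] -/
theorem toricHGP_x_phenom_isThresholdLowerBound_of_lattice {p₀ : ℝ}
    (hX : ∀ (T' : ℕ → ℕ), IsPolyBounded T' →
      ∀ DX' : (L : ℕ) → CSSPhenom.STDecoder (Vertex (L + 1)) (Edge (L + 1)) (T' L),
        (∀ L, (DX' L).IsMinWeight (CSSPhenom.stSyn (toricCode (L + 1)).HZ (T' L))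
          (CSSPhenom.stCycles (toricCode (L + 1)).HZ (T' L)) hammingNorm) →
        IsThresholdLowerBound (xPhenomFailureFamily (fun L => toricCode (L + 1)) T' DX') p₀)
    {T : ℕ → ℕ} (hT : IsPolyBounded T)
    (DX : ∀ k, CSSPhenom.STDecoder (Fin (k + 2) × Fin (k + 2))
      ((Fin (k + 2) × Fin (k + 2)) ⊕ (Fin (k + 2) × Fin (k + 2))) (T k))
    (hDX : ∀ k, (DX k).IsMinWeight (CSSPhenom.stSyn (toricHGPCode k).HZ (T k))
      (CSSPhenom.stCycles (toricHGPCode k).HZ (T k)) hammingNorm) :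
    IsThresholdLowerBound (xPhenomFailureFamily (fun k => toricHGPCode k) T DX) p₀ := by
  let T' : ℕ → ℕ := fun L => T (L - 1)
  have hT' : IsPolyBounded T' := isPolyBounded_pred hT
  let DX' : (L : ℕ) → CSSPhenom.STDecoder (Vertex (L + 1)) (Edge (L + 1)) (T' L) := fun L =>
    match L with
    | 0 => Decoder.minWeight (CSSPhenom.stSyn (toricCode 1).HZ (T' 0)) hammingNorm
    | k + 1 => fun s : CSSPhenom.STSyndrome (Vertex (k + 2)) (T k) =>
        DX k (s ∘ ⇑((toricVertexEquiv k).symm.prodCongr (Equiv.refl (Fin (T k + 1)))).symm) ∘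
          ⇑(Equiv.sumCongr ((toricQubitEquiv k).symm.prodCongr (Equiv.refl (Fin (T k))))
            ((toricVertexEquiv k).symm.prodCongr (Equiv.refl (Fin (T k)))))
  have hDX' : ∀ L, (DX' L).IsMinWeight (CSSPhenom.stSyn (toricCode (L + 1)).HZ (T' L))
      (CSSPhenom.stCycles (toricCode (L + 1)).HZ (T' L)) hammingNorm := by
    intro L
    cases L with
    | zero => exact CSSPhenom.isMinWeight_minWeight _ _
    | succ k => exact toricHGP_isMinWeight_stPullback_x k (T k) (hDX k)
  have hfam : xPhenomFailureFamily (fun k => toricHGPCode k) T DX =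
      fun k => xPhenomFailureFamily (fun L => toricCode (L + 1)) T' DX' (k + 1) := by
    funext k p
    exact toricHGP_xPhenomFailureProb_eq k (T k) (DX k) p p
  rw [hfam, isThresholdLowerBound_succ_iff]
  exact hX T' hT' DX' hDX'

/-- **`X`-sector phenomenological threshold of `HGP(circ_L, circ_L)` `≥ p₀(4.7476)`** (plaquette record), poly `T`, every
minimum-weight space-time decoder family — UNCONDITIONAL, kernel. [cite: DennisEtAl2002, §5.3 eq. (threshold_iso_num)] -/
theorem toricHGP_x_phenom_isThresholdLowerBound_kernelZ3SymmK12 {T : ℕ → ℕ} (hT : IsPolyBounded T)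
    (DX : ∀ k, CSSPhenom.STDecoder (Fin (k + 2) × Fin (k + 2))
      ((Fin (k + 2) × Fin (k + 2)) ⊕ (Fin (k + 2) × Fin (k + 2))) (T k))
    (hDX : ∀ k, (DX k).IsMinWeight (CSSPhenom.stSyn (toricHGPCode k).HZ (T k))
      (CSSPhenom.stCycles (toricHGPCode k).HZ (T k)) hammingNorm) :
    IsThresholdLowerBound (xPhenomFailureFamily (fun k => toricHGPCode k) T DX) (thresholdValue 4.7476) :=
  toricHGP_x_phenom_isThresholdLowerBound_of_lattice
    (fun _ hT' DX' hDX' => toric_x_phenom_isThresholdLowerBound_kernelZ3SymmK12 hT' DX' hDX') hT DX hDX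

/-- **`p_c^{X,ph} > .0112` for `HGP(circ_L, circ_L)`** (plaquette record; was `.0101`), poly `T`, every minimum-weight space-time
decoder family — UNCONDITIONAL, kernel. [cite: DennisEtAl2002, §5.3 eq. (threshold_iso_num)] -/
theorem toricHGP_x_phenom_accuracyThreshold_gt_0112 {T : ℕ → ℕ} (hT : IsPolyBounded T)
    (DX : ∀ k, CSSPhenom.STDecoder (Fin (k + 2) × Fin (k + 2))
      ((Fin (k + 2) × Fin (k + 2)) ⊕ (Fin (k + 2) × Fin (k + 2))) (T k))
    (hDX : ∀ k, (DX k).IsMinWeight (CSSPhenom.stSyn (toricHGPCode k).HZ (T k))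
      (CSSPhenom.stCycles (toricHGPCode k).HZ (T k)) hammingNorm) :
    (0.0112 : ℝ) < accuracyThreshold (xPhenomFailureFamily (fun k => toricHGPCode k) T DX) :=
  lt_of_lt_of_le thresholdValue_47476_bounds.1
    (le_accuracyThreshold (toricHGP_x_phenom_isThresholdLowerBound_kernelZ3SymmK12 hT DX hDX)
      ((thresholdValue_le_half _).trans (by norm_num)))

/-- **Transfer principle, `X` sector, two-rate boxes.** [cite: LinPryadko2024, §4.2 Thm 6] [cite: DennisEtAl2002, §5.3 eq. (threshold_iso)] -/
theorem toricHGP_x_phenom_isThresholdBoxLowerBound_of_lattice {ρ₀ : ℝ}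
    (hX : ∀ (T' : ℕ → ℕ), IsPolyBounded T' →
      ∀ DX' : (L : ℕ) → CSSPhenom.STDecoder (Vertex (L + 1)) (Edge (L + 1)) (T' L),
        (∀ L, (DX' L).IsMinWeight (CSSPhenom.stSyn (toricCode (L + 1)).HZ (T' L))
          (CSSPhenom.stCycles (toricCode (L + 1)).HZ (T' L)) hammingNorm) →
        IsThresholdBoxLowerBound (xPhenomFailureFamily₂ (fun L => toricCode (L + 1)) T' DX') ρ₀)
    {T : ℕ → ℕ} (hT : IsPolyBounded T)
    (DX : ∀ k, CSSPhenom.STDecoder (Fin (k + 2) × Fin (k + 2))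
      ((Fin (k + 2) × Fin (k + 2)) ⊕ (Fin (k + 2) × Fin (k + 2))) (T k))
    (hDX : ∀ k, (DX k).IsMinWeight (CSSPhenom.stSyn (toricHGPCode k).HZ (T k))
      (CSSPhenom.stCycles (toricHGPCode k).HZ (T k)) hammingNorm) :
    IsThresholdBoxLowerBound (xPhenomFailureFamily₂ (fun k => toricHGPCode k) T DX) ρ₀ := by
  let T' : ℕ → ℕ := fun L => T (L - 1)
  have hT' : IsPolyBounded T' := isPolyBounded_pred hT
  let DX' : (L : ℕ) → CSSPhenom.STDecoder (Vertex (L + 1)) (Edge (L + 1)) (T' L) := fun L =>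
    match L with
    | 0 => Decoder.minWeight (CSSPhenom.stSyn (toricCode 1).HZ (T' 0)) hammingNorm
    | k + 1 => fun s : CSSPhenom.STSyndrome (Vertex (k + 2)) (T k) =>
        DX k (s ∘ ⇑((toricVertexEquiv k).symm.prodCongr (Equiv.refl (Fin (T k + 1)))).symm) ∘
          ⇑(Equiv.sumCongr ((toricQubitEquiv k).symm.prodCongr (Equiv.refl (Fin (T k))))
            ((toricVertexEquiv k).symm.prodCongr (Equiv.refl (Fin (T k)))))
  have hDX' : ∀ L, (DX' L).IsMinWeight (CSSPhenom.stSyn (toricCode (L + 1)).HZ (T' L))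
      (CSSPhenom.stCycles (toricCode (L + 1)).HZ (T' L)) hammingNorm := by
    intro L
    cases L with
    | zero => exact CSSPhenom.isMinWeight_minWeight _ _
    | succ k => exact toricHGP_isMinWeight_stPullback_x k (T k) (hDX k)
  have hfam : xPhenomFailureFamily₂ (fun k => toricHGPCode k) T DX =
      fun k => xPhenomFailureFamily₂ (fun L => toricCode (L + 1)) T' DX' (k + 1) := by
    funext k p q
    exact toricHGP_xPhenomFailureProb_eq k (T k) (DX k) p q
  rw [hfam, isThresholdBoxLowerBound_succ_iff]
  exact hX T' hT' DX' hDX'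

/-- **Two-rate `X`-sector box `p₀(4.7476)`** for the HGP object (plaquette record), poly `T`, every minimum-weight space-time
decoder family — UNCONDITIONAL, kernel. [cite: DennisEtAl2002, §5.3 eqs. (threshold_iso), (threshold_iso_num)] -/
theorem toricHGP_x_phenom_isThresholdBoxLowerBound_kernelZ3SymmK12 {T : ℕ → ℕ} (hT : IsPolyBounded T)
    (DX : ∀ k, CSSPhenom.STDecoder (Fin (k + 2) × Fin (k + 2))
      ((Fin (k + 2) × Fin (k + 2)) ⊕ (Fin (k + 2) × Fin (k + 2))) (T k))
    (hDX : ∀ k, (DX k).IsMinWeight (CSSPhenom.stSyn (toricHGPCode k).HZ (T k))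
      (CSSPhenom.stCycles (toricHGPCode k).HZ (T k)) hammingNorm) :
    IsThresholdBoxLowerBound (xPhenomFailureFamily₂ (fun k => toricHGPCode k) T DX) (thresholdValue 4.7476) :=
  toricHGP_x_phenom_isThresholdBoxLowerBound_of_lattice
    (fun _ hT' DX' hDX' => toric_x_phenom_isThresholdBoxLowerBound_kernelZ3SymmK12 hT' DX' hDX') hT DX hDX

/-! ### Three rates: phenomenological depolarizing noise -/

/-- **`HGP(circ_L, circ_L)` under phenomenological DEPOLARIZING noise, sector-wise minimum-weight space-time decoding:
`p ≤ .0168`, `q_X, q_Z ≤ .0112` ⇒ `P_fail → 0`** (was `.0151 / .0101`), poly `T` — UNCONDITIONAL, kernel.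
[cite: AliferisGottesmanPreskill2006, §8.2 (chunk p0026 L11)] [cite: DennisEtAl2002, §5.3 eq. (threshold_iso_num)] -/
theorem toricHGP_depolPhenom_belowThreshold_0168_0112 {T : ℕ → ℕ} (hT : IsPolyBounded T)
    (DZ DX : ∀ k, CSSPhenom.STDecoder (Fin (k + 2) × Fin (k + 2))
      ((Fin (k + 2) × Fin (k + 2)) ⊕ (Fin (k + 2) × Fin (k + 2))) (T k))
    (hDZ : ∀ k, (DZ k).IsMinWeight (CSSPhenom.stSyn (toricHGPCode k).HX (T k))
      (CSSPhenom.stCycles (toricHGPCode k).HX (T k)) hammingNorm)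
    (hDX : ∀ k, (DX k).IsMinWeight (CSSPhenom.stSyn (toricHGPCode k).HZ (T k))
      (CSSPhenom.stCycles (toricHGPCode k).HZ (T k)) hammingNorm)
    {p qX qZ : ℝ} (hp0 : 0 ≤ p) (hp : p ≤ 0.0168) (hqX0 : 0 ≤ qX) (hqX : qX ≤ 0.0112) (hqZ0 : 0 ≤ qZ)
    (hqZ : qZ ≤ 0.0112) :
    Tendsto (fun k => (toricHGPCode k).depolPhenomFailureProb (T k) (DZ k) (DX k) p qX qZ) atTop (𝓝 0) := by
  have h := thresholdValue_47476_bounds.1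
  have hv : thresholdValue (4.7476 : ℝ) ≤ 1 / 2 := thresholdValue_le_half _
  exact CSSCode.depolPhenom_belowThreshold_of_box (fun k => toricHGPCode k) T DZ DX
    (toricHGP_z_phenom_isThresholdBoxLowerBound_kernelZ3SymmK12 hT DZ hDZ)
    (toricHGP_x_phenom_isThresholdBoxLowerBound_kernelZ3SymmK12 hT DX hDX)
    hp0 (by linarith) (by linarith) hqX0 (by linarith) (by linarith) hqZ0 (by linarith) (by linarith)

end Summit.Ventures.QEC.Thresholds

end
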